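import Literature.NumberTheory.ModularForms.CohenEisensteinLValueViaLSeries
import Literature.NumberTheory.LFunctions.KroneckerCharacterPrimitive
import Literature.NumberTheory.LFunctions.PrimitiveQuadraticCharacterGaussSum
import HarnessLib

/-!
# Cohen's `h(r, N)` for EVERY fundamental discriminant (odd and even conductor):
# `L(1 − r, χ_D) = (−1)^{[r/2]} (r−1)! 2^{1−r} |D|^{r−1/2} π^{−r} L(r, χ_D)`, `χ_D` the Kronecker character

Topic `Literature/NumberTheory/ModularForms` (sub-namespace `CohenEisenstein`). THEOREMS ONLY (no definition, no named fact).

The companion file `CohenEisensteinLValueViaLSeries.lean` proves, for ODD fundamental discriminants `D ≡ 1 (mod 4)`, the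
identity behind Cohen's definition of `h(r, N)` [Cohen1975, §2]: the rational number `lValueDisc r D = L(1 − r, χ_D) = −B_{r,χ_D}/r`
(`CohenEisensteinCoefficients.lean`) equals `(−1)^{⌊r/2⌋} (r−1)!/2^{r−1} · |D|^{r−1} √|D| π^{−r} · L(r, χ_D)` whenever `r ≥ 2` and
`χ_D(−1) = (−1)^r`, through the tree's Jacobi character `(·/|D|)`. This file removes the parity restriction on `D`: the SAME
identity for every fundamental discriminant `D` (`D ≡ 1 (mod 4)` square-free, or `D = 4m`, `m ≡ 2, 3 (mod 4)` square-free), with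
`χ_D` the tree's TERM `KroneckerCharacter.kroneckerChar D : DirichletCharacter ℂ |D|` (`LFunctions/KroneckerCharacter.lean`;
primitive of conductor `|D|`, `LFunctions/KroneckerCharacterPrimitive.lean`). The two inputs that the even conductor needs and
that the tree ALREADY holds are: Gauss's evaluation WITH SIGN of `τ(χ)` for an arbitrary primitive quadratic character
(`PrimitiveQuadratic.gaussSum_eq_of_isQuadratic`, Montgomery–Vaughan Thm. 9.17 incl. `τ(χ₋₄) = 2i`, `τ(χ_{±8})` and the CRT
multiplicativity Thm. 9.6), and Apostol's `L(r, ψ) = −(2πi)^r B_{r,ψ̄}/(2·r!·N^{r−1}·τ(ψ̄))` (`LFunctions.LFunction_eq_bernoulli`).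

What is proved:
* `kroneckerChar_natCast_eq_chiDisc` — `χ_D(c) = chiDisc D c` for every `c : ℕ` and every fundamental `D` (the values of the
  term `kroneckerChar D` ARE Cohen's Kronecker symbol `CohenEisenstein.chiDisc D`; from the tree's prime-value certificate
  `isKroneckerChar_kroneckerChar` by multiplicativity);
* `kroneckerChar_neg_one` — `χ_D(−1) = sign D` (Montgomery–Vaughan Thm. 9.13: `χ_d` is even iff `d > 0`);
* **`algebraMap_lValueDisc_eq_LFunction_kroneckerChar`** — the displayed identity with Mathlib's `LFunction` of `kroneckerChar D`,
  every fundamental `D`, `r ≥ 2`, parity `(0 < D ∧ Even r) ∨ (D < 0 ∧ Odd r)`;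
* **`algebraMap_lValueDisc_eq_LSeries_chiDisc`** — the character-free reading with the convergent series
  `LSeries (n ↦ χ_D(n)) r = Σ_{n ≥ 1} χ_D(n) n^{−r}`, for `D = 1` (Euler's `ζ(1 − r) = … ζ(r)`, `r` even) OR `D` fundamental — i.e.
  exactly the first clause of `CohenEisenstein.IsDiscDecomposition`;
* **`algebraMap_cohenH_eq_LSeries_chiDisc_mul_cohenT`** — hence, PARITY-FREE: for every decomposition `(−1)^r N = D f²` of Cohen's
  definition and `r ≥ 2`, `H(r, N) = (−1)^{⌊r/2⌋} (r−1)!/2^{r−1} · |D|^{r−1} √|D| π^{−r} · (Σ_n χ_D(n) n^{−r}) · T_r(D, f)` in `ℂ`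
  (the sign condition `χ_D(−1) = (−1)^r` is automatic: `sign D = (−1)^r`).
Use: ingredient (C) of the cusp-constant computation for the `m`-cut Cohen–Eisenstein series with EVEN `m` (crux
`PrintCFram.BottomClassIndexLawFiveLe`, cell `bsd-print-cfram`, crux notes `…-w5g5-cusp-seed.md` §15); no claim beyond print.

References: [Cohen1975] §2 (definition of `h(r, N)` and `H(r, N)`); [MontgomeryVaughan2007] §9.3 Thm. 9.13, Thm. 9.17;
[Washington1997] Thm. 4.2; [Apostol1976] Thm. 12.19.
-/

noncomputable section

open Complex
open scoped NumberTheorySymbols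

namespace Literature.NumberTheory.ModularForms.CohenEisenstein

open Literature.NumberTheory.LFunctions
open Literature.NumberTheory.LFunctions.KroneckerCharacter (kroneckerChar kroneckerChar_of_odd isQuadratic_kroneckerChar
  isKroneckerChar_kroneckerChar isPrimitive_kroneckerChar three_le_natAbs_of_isFundamentalDiscriminant)
open Literature.Barriers.RiemannHypothesis (IsFundamentalDiscriminant)

/-! ## §1 The values of `kroneckerChar D` are Cohen's `χ_D` -/

/-- **The Kronecker character `χ_D` (the tree's term `kroneckerChar D`, a Dirichlet character mod `|D|`) has the values
`chiDisc D c = (D/c)` at every natural number `c`**, for every fundamental discriminant `D` — odd (`χ_D = (·/|D|)`, Jacobi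
reciprocity packaged in `chiDisc`) and even (`χ_D(c) = 0` at even `c`, `= (D/c)` (Jacobi) at odd `c`; from the prime values
`isKroneckerChar_kroneckerChar` by complete multiplicativity of both sides). [cite: MontgomeryVaughan2007, §9.3, Thm. 9.13] -/
theorem kroneckerChar_natCast_eq_chiDisc {D : ℤ} (hD : IsFundamentalDiscriminant D) [NeZero D.natAbs] (c : ℕ) :
    kroneckerChar D (c : ZMod D.natAbs) = (chiDisc D c : ℂ) := by
  rcases hD with ⟨h1, -, -⟩ | ⟨h4, h23, hsq⟩
  · rw [kroneckerChar_of_odd h1, KroneckerCharacter.jacobiChar_natCast, chiDisc_of_emod_four_eq_one h1]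
  · have hD : IsFundamentalDiscriminant D := Or.inr ⟨h4, h23, hsq⟩
    have hD4 : D % 4 ≠ 1 := by omega
    obtain ⟨-, hprime, htwo⟩ := isKroneckerChar_kroneckerChar hD
    have h3 := three_le_natAbs_of_isFundamentalDiscriminant hD
    -- complete multiplicativity of `chiDisc D` (`D ≢ 1 (mod 4)`: parity clause + Jacobi multiplicativity in the bottom argument)
    have hmul : ∀ a b : ℕ, chiDisc D (a * b) = chiDisc D a * chiDisc D b := by
      intro a b
      rcases Nat.even_or_odd a with ha | ha
      · rw [chiDisc_of_emod_four_ne_one_of_even hD4 ha, chiDisc_of_emod_four_ne_one_of_even hD4 (ha.mul_right b),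
          zero_mul]
      rcases Nat.even_or_odd b with hb | hb
      · rw [chiDisc_of_emod_four_ne_one_of_even hD4 hb, chiDisc_of_emod_four_ne_one_of_even hD4 (hb.mul_left a),
          mul_zero]
      rw [chiDisc_of_emod_four_ne_one_of_odd hD4 ha, chiDisc_of_emod_four_ne_one_of_odd hD4 hb,
        chiDisc_of_emod_four_ne_one_of_odd hD4 (ha.mul hb), jacobiSym.mul_right' D ha.pos.ne' hb.pos.ne']
    induction c using Nat.recOnMul with
    | zero =>
      haveI : Fact (1 < D.natAbs) := ⟨by omega⟩
      rw [Nat.cast_zero, MulChar.map_nonunit _ not_isUnit_zero, chiDisc_of_emod_four_ne_one_of_even hD4 (⟨0, rfl⟩ : Even 0),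
        Int.cast_zero]
    | one => rw [Nat.cast_one, map_one, chiDisc_one_right, Int.cast_one]
    | prime p hp =>
      by_cases hp2 : p = 2
      · subst hp2
        have h8 : ¬ D % 8 = 1 := by omega
        have h8' : ¬ D % 8 = 5 := by omega
        rw [if_neg h8, if_neg h8'] at htwo
        rw [Nat.cast_ofNat, htwo, chiDisc_of_emod_four_ne_one_of_even hD4 even_two, Int.cast_zero]
      · rw [hprime p hp hp2, chiDisc_of_emod_four_ne_one_of_odd hD4 (hp.odd_of_ne_two hp2)]
    | mul a b ha hb => rw [Nat.cast_mul, map_mul, ha, hb, hmul, Int.cast_mul]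

/-! ## §2 Parity: `χ_D(−1) = sign D` -/

/-- **`χ_D(−1) = sign D`**: the Kronecker character of a fundamental discriminant `D` is even iff `D > 0`
(Montgomery–Vaughan Thm. 9.13: «`χ_d(−1) = 1` if and only if `d > 0`»). Odd `D`: `χ_D(−1) = (−1/|D|) = χ₄(|D|)`. Even `D`: compare,
at the odd residue `c = 2|D| − 1 ≡ −1`, the two descriptions `χ_D(c) = (χ_D(−1)|D| / c)` (`PrimitiveQuadratic.apply_natCast_eq_jacobiSym_sign_mul`)
and `χ_D(c) = (D/c)` (§1): since `χ₄(c) = −1` and `χ_D(c) = χ_D(−1) ≠ 0`, the two signs agree.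
[cite: MontgomeryVaughan2007, §9.3, Thm. 9.13] -/
theorem kroneckerChar_neg_one {D : ℤ} (hD : IsFundamentalDiscriminant D) [NeZero D.natAbs] :
    kroneckerChar D (-1) = if 0 < D then 1 else -1 := by
  set n : ℕ := D.natAbs with hn
  have hn0 : n ≠ 0 := NeZero.ne n
  have h3 : 3 ≤ n := three_le_natAbs_of_isFundamentalDiscriminant hD
  have hnD : (0 < D ∧ (n : ℤ) = D) ∨ (¬ 0 < D ∧ (n : ℤ) = -D) := by
    rcases Int.natAbs_eq D with h | h
    · exact Or.inl ⟨by omega, h.symm⟩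
    · exact Or.inr ⟨by omega, by omega⟩
  -- `−1 ≡ n − 1`, so `χ_D(−1) = chiDisc D (n − 1)`
  have hcast : ((n - 1 : ℕ) : ZMod n) = -1 := by
    rw [Nat.cast_sub (by omega : 1 ≤ n), Nat.cast_one, ZMod.natCast_self, zero_sub]
  have hval : kroneckerChar D (-1) = (chiDisc D (n - 1) : ℂ) := by
    rw [← hcast, kroneckerChar_natCast_eq_chiDisc hD]
  rcases hD with ⟨h1, -, -⟩ | ⟨h4, h23, hsq⟩
  · -- odd `D`: `(n−1 / n) = (−1 / n) = χ₄(n)`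
    have hodd : Odd n := by rcases hnD with ⟨-, h⟩ | ⟨-, h⟩ <;> exact Nat.odd_iff.mpr (by omega)
    have hmod : ((n - 1 : ℕ) : ℤ) % (n : ℕ) = (-1 : ℤ) % (n : ℕ) :=
      (Int.modEq_iff_dvd.mpr ⟨-1, by push_cast [Nat.cast_sub (by omega : 1 ≤ n)]; ring⟩).eq
    rw [hval, chiDisc_of_emod_four_eq_one h1, ← hn, jacobiSym.mod_left' hmod, jacobiSym.at_neg_one hodd]
    rcases hnD with ⟨hpos, h⟩ | ⟨hneg, h⟩
    · rw [if_pos hpos, ZMod.χ₄_nat_one_mod_four (by omega)]; norm_num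
    · rw [if_neg hneg, ZMod.χ₄_nat_three_mod_four (by omega)]; norm_num
  · -- even `D`
    have hD : IsFundamentalDiscriminant D := Or.inr ⟨h4, h23, hsq⟩
    have hD4 : D % 4 ≠ 1 := by omega
    have h4n : 4 ∣ n := by
      have := Int.natAbs_dvd_natAbs.mpr h4
      simpa using this
    set ψ := kroneckerChar D with hψ_def
    have hprim : ψ.IsPrimitive := isPrimitive_kroneckerChar hD
    have hquad : ψ.IsQuadratic := isQuadratic_kroneckerChar D
    obtain ⟨s, hs1, hs⟩ := PrimitiveQuadratic.exists_sign_eq ψ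
    have hs1' : s = 1 ∨ s = -1 := by
      rcases hs1 with ⟨h, -⟩ | ⟨h, -⟩
      · exact Or.inl h
      · exact Or.inr h
    -- the witness residue `c = 2n − 1`
    set c : ℕ := 2 * n - 1 with hc
    have hc_odd : Odd c := ⟨n - 1, by omega⟩
    have hc4 : c % 4 = 3 := by omega
    have hc_cast : (c : ZMod n) = -1 := by
      have h2n : ((2 * n : ℕ) : ZMod n) = 0 := by rw [Nat.cast_mul, ZMod.natCast_self, mul_zero]
      rw [hc, Nat.cast_sub (by omega : 1 ≤ 2 * n), h2n, Nat.cast_one, zero_sub]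
    -- two descriptions of `ψ c`
    have hA : ψ (c : ZMod n) = (J(s * n | c) : ℂ) :=
      PrimitiveQuadratic.apply_natCast_eq_jacobiSym_sign_mul hprim hquad hs hs1' hc_odd
    have hB : ψ (c : ZMod n) = (J(D | c) : ℂ) := by
      rw [hψ_def, kroneckerChar_natCast_eq_chiDisc hD, chiDisc_of_emod_four_ne_one_of_odd hD4 hc_odd]
    have hψc : ψ (c : ZMod n) = (s : ℂ) := by rw [hc_cast, hs]
    -- `(−a / c) = −(a / c)` since `c ≡ 3 (mod 4)`
    have hneg : ∀ a : ℤ, J(-a | c) = -J(a | c) := fun a => by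
      rw [jacobiSym.neg _ hc_odd, ZMod.χ₄_nat_three_mod_four hc4]; ring
    have hJ : J(s * n | c) = J(D | c) := by exact_mod_cast hA.symm.trans hB
    have hJs : (J(s * n | c) : ℂ) = s := hA.symm.trans hψc
    have hs0 : (J(s * n | c) : ℤ) ≠ 0 := by
      intro h0
      rw [h0, Int.cast_zero] at hJs
      rcases hs1' with rfl | rfl <;> norm_num at hJs
    rw [show kroneckerChar D (-1) = (s : ℂ) from hs]
    rcases hnD with ⟨hpos, h⟩ | ⟨hneg', h⟩
    · rw [if_pos hpos]
      rcases hs1' with rfl | rfl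
      · norm_num
      · -- `s = −1`, `D = n`: `(−n/c) = (n/c)` forces `(n/c) = 0`
        exfalso
        rw [← h, neg_one_mul, hneg] at hJ
        rw [neg_one_mul, hneg] at hs0
        exact hs0 (by linarith)
    · rw [if_neg hneg']
      rcases hs1' with rfl | rfl
      · -- `s = 1`, `D = −n`
        exfalso
        rw [one_mul, show D = -(n : ℤ) by omega, hneg] at hJ
        rw [one_mul] at hs0
        exact hs0 (by linarith)
      · norm_num

/-- `χ_D(−1) = (−1)^r` under Cohen's parity condition (`D > 0`, `r` even, or `D < 0`, `r` odd).
[cite: MontgomeryVaughan2007, §9.3, Thm. 9.13] -/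
theorem kroneckerChar_neg_one_eq_pow {D : ℤ} (hD : IsFundamentalDiscriminant D) [NeZero D.natAbs] {r : ℕ}
    (hpar : (0 < D ∧ Even r) ∨ (D < 0 ∧ Odd r)) : kroneckerChar D (-1) = (-1) ^ r := by
  rw [kroneckerChar_neg_one hD]
  rcases hpar with ⟨hpos, hev⟩ | ⟨hneg, hod⟩
  · rw [if_pos hpos, hev.neg_one_pow]
  · rw [if_neg (not_lt.mpr hneg.le), hod.neg_one_pow]

/-! ## §3 The identity with `L(r, χ_D)` for every fundamental discriminant -/

/-- **Cohen's `h(r, |D|)` for EVERY fundamental discriminant: `L(1 − r, χ_D) = (−1)^{⌊r/2⌋} (r−1)! 2^{1−r} |D|^{r−1/2} π^{−r} L(r, χ_D)`**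
(`D ≡ 1 (mod 4)` square-free, or `D = 4m` with `m ≡ 2, 3 (mod 4)` square-free; `r ≥ 2` with `χ_D(−1) = (−1)^r`, i.e. `D > 0`,
`r` even, or `D < 0`, `r` odd); left side in the rational currency `lValueDisc r D = −B_{r,χ_D}/r`, right side with Mathlib's
`LFunction` of the Kronecker character `kroneckerChar D` mod `|D|`. From `LFunction_eq_bernoulli` (Apostol 12.19) and Gauss's
`τ(χ_D) = √D` (Montgomery–Vaughan 9.17, `PrimitiveQuadratic.gaussSum_eq_of_isQuadratic`).
[cite: Cohen1975, §2 (definition of h(r,N) and of H(r,N))] [cite: MontgomeryVaughan2007, §9.3, Thm. 9.17]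
[cite: Washington1997, Thm. 4.2] -/
theorem algebraMap_lValueDisc_eq_LFunction_kroneckerChar {D : ℤ} (hD : IsFundamentalDiscriminant D) [NeZero D.natAbs]
    {r : ℕ} (hr : 2 ≤ r) (hpar : (0 < D ∧ Even r) ∨ (D < 0 ∧ Odd r)) :
    algebraMap ℚ ℂ (lValueDisc r D) =
      (-1 : ℂ) ^ (r / 2) * ((r - 1).factorial : ℂ) / 2 ^ (r - 1) * (D.natAbs : ℂ) ^ (r - 1) *
        (Real.sqrt D.natAbs : ℂ) / (Real.pi : ℂ) ^ r * (kroneckerChar D).LFunction r := by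
  set n : ℕ := D.natAbs with hn
  have hn0 : n ≠ 0 := NeZero.ne n
  set ψ : DirichletCharacter ℂ n := kroneckerChar D with hψ_def
  have hprim : ψ.IsPrimitive := isPrimitive_kroneckerChar hD
  have hquad : ψ.IsQuadratic := isQuadratic_kroneckerChar D
  have hinv : ψ⁻¹ = ψ := hquad.inv
  have hψ : ∀ c : ℕ, ψ (c : ZMod n) = (chiDisc D c : ℂ) := fun c => kroneckerChar_natCast_eq_chiDisc hD c
  have hL := algebraMap_lValueDisc (R := ℂ) r ψ hψ
  have hparψ : ψ (-1) = (-1) ^ r := kroneckerChar_neg_one_eq_pow hD hpar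
  have hB := LFunction_eq_bernoulli ψ hprim hr hparψ
  rw [hinv] at hB
  have hτ0 : gaussSum ψ (ZMod.stdAddChar (N := n)) ≠ 0 := by
    have h := gaussSum_ne_zero ψ⁻¹ (isPrimitive_inv ψ hprim)
    rwa [hinv] at h
  have hπ : (Real.pi : ℂ) ≠ 0 := by exact_mod_cast Real.pi_ne_zero
  have h2πI : (2 * (Real.pi : ℂ) * I) ^ r ≠ 0 := pow_ne_zero _ (by simp [Real.pi_ne_zero, I_ne_zero])
  have hfac : ((r.factorial : ℕ) : ℂ) ≠ 0 := by exact_mod_cast r.factorial_ne_zero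
  have hnC : (n : ℂ) ≠ 0 := by exact_mod_cast hn0
  have hrC : (r : ℂ) ≠ 0 := by exact_mod_cast (show r ≠ 0 by omega)
  have hsqrt : (Real.sqrt n : ℂ) ≠ 0 := by
    exact_mod_cast (Real.sqrt_pos.mpr (by exact_mod_cast Nat.pos_of_ne_zero hn0)).ne'
  -- `B_{r,ψ}` in terms of `L(r,ψ)`
  have hBval : generalizedBernoulli r ψ =
      -(ψ.LFunction r * (2 * r.factorial * (n : ℂ) ^ (r - 1) * gaussSum ψ (ZMod.stdAddChar (N := n)))) /
        (2 * Real.pi * I) ^ r := by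
    rw [hB]
    field_simp
  -- factorial and power bookkeeping
  have hfac' : (r.factorial : ℂ) = r * ((r - 1).factorial : ℂ) := by
    rw [← Nat.mul_factorial_pred (by omega : r ≠ 0)]
    push_cast
    ring
  have h2pow : (2 : ℂ) ^ r = 2 * 2 ^ (r - 1) := by
    rw [← pow_succ', Nat.sub_add_cancel (by omega : 1 ≤ r)]
  have hI : (I : ℂ) ^ r ≠ 0 := pow_ne_zero _ I_ne_zero
  -- Gauss's sign, uniformly in the parity: `τ(χ_D) = (−1)^{⌊r/2⌋} √|D| · i^r`
  have hτ := PrimitiveQuadratic.gaussSum_eq_of_isQuadratic hprim hquad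
  have hτI : gaussSum ψ (ZMod.stdAddChar (N := n)) = (-1 : ℂ) ^ (r / 2) * (Real.sqrt n : ℂ) * I ^ r := by
    rcases hpar with ⟨hDpos, ⟨j, hj⟩⟩ | ⟨hDneg, ⟨j, hj⟩⟩
    · have heven : ψ.Even := by
        show ψ (-1) = 1
        rw [hparψ, hj, ← two_mul, pow_mul, neg_one_sq, one_pow]
      have hdiv : r / 2 = j := by omega
      have hIr : I ^ r = (-1) ^ j := by rw [hj, ← two_mul, pow_mul, I_sq]
      rw [hτ, if_pos heven, hdiv, hIr, mul_comm ((-1 : ℂ) ^ j) _, mul_assoc, ← mul_pow, neg_one_mul, neg_neg, one_pow,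
        mul_one]
    · have hodd : ¬ ψ.Even := by
        show ¬ ψ (-1) = 1
        rw [hparψ, hj, pow_succ, pow_mul, neg_one_sq, one_pow, one_mul]
        norm_num
      have hdiv : r / 2 = j := by omega
      have hIr : I ^ r = (-1) ^ j * I := by rw [hj, pow_succ, pow_mul, I_sq]
      rw [hτ, if_neg hodd, hdiv, hIr]
      have hm1 : ((-1 : ℂ) ^ j) * ((-1 : ℂ) ^ j) = 1 := by
        rw [← mul_pow, neg_one_mul, neg_neg, one_pow]
      linear_combination (-(I * (Real.sqrt n : ℂ))) * hm1
  rw [hL, hBval, hτI, mul_pow (2 * (Real.pi : ℂ)) I r, mul_pow (2 : ℂ) (Real.pi : ℂ) r, hfac', h2pow]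
  field_simp
  ring

/-! ## §4 The character-free reading: `L(r, χ_D)` as the convergent series `Σ χ_D(n) n^{−r}` -/

/-- For `r ≥ 2`, `L(r, χ_D)` (Mathlib's `LFunction` of `kroneckerChar D`) is the absolutely convergent series
`Σ_{n ≥ 1} χ_D(n) n^{−r}` with the integer weights `chiDisc D n`. [cite: MontgomeryVaughan2007, §9.3, Thm. 9.13] -/
theorem LFunction_kroneckerChar_eq_LSeries_chiDisc {D : ℤ} (hD : IsFundamentalDiscriminant D) [NeZero D.natAbs] {r : ℕ}
    (hr : 2 ≤ r) : (kroneckerChar D).LFunction r = LSeries (fun n => (chiDisc D n : ℂ)) r := by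
  have hs : 1 < (r : ℂ).re := by simp only [natCast_re, Nat.one_lt_cast]; omega
  rw [DirichletCharacter.LFunction_eq_LSeries _ hs]
  exact LSeries_congr (fun {n} _ => kroneckerChar_natCast_eq_chiDisc hD n) r

/-- The `D = 1` instance of the identity (Euler): `ζ(1 − r) = −B_r/r = (−1)^{r/2} (r−1)! 2^{1−r} π^{−r} ζ(r)` for even `r ≥ 2`,
in the same shape as the fundamental case (`|1|^{r−1} √1 = 1`, `χ_1 ≡ 1`, `Σ n^{−r} = ζ(r)`), `lValueDisc r 1 = −B_r/r`.
[cite: Washington1997, Thm. 4.2] -/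
theorem algebraMap_lValueDisc_one_eq_LSeries {r : ℕ} (hr : 2 ≤ r) (hev : Even r) :
    algebraMap ℚ ℂ (lValueDisc r 1) =
      (-1 : ℂ) ^ (r / 2) * ((r - 1).factorial : ℂ) / 2 ^ (r - 1) * ((1 : ℤ).natAbs : ℂ) ^ (r - 1) *
        (Real.sqrt (1 : ℤ).natAbs : ℂ) / (Real.pi : ℂ) ^ r * LSeries (fun n => (chiDisc 1 n : ℂ)) r := by
  obtain ⟨k, hk⟩ := hev
  have hk0 : k ≠ 0 := by omega
  have hrk : r = 2 * k := by omega
  have hs : 1 < (r : ℂ).re := by simp only [natCast_re, Nat.one_lt_cast]; omega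
  -- the left side: `−B_r/r`
  have hB1 : bernoulliDisc r 1 = bernoulli r := by
    rw [bernoulliDisc, Int.natAbs_one, Finset.sum_range_one, chiDisc_one_left, Int.cast_one, one_mul,
      genBernoulliCoeff_of_one_le (by omega : 1 ≤ r), Nat.cast_one, one_pow, one_mul, Nat.cast_zero, zero_div,
      Polynomial.bernoulli_eval_zero]
  have hL : algebraMap ℚ ℂ (lValueDisc r 1) = -((bernoulli r : ℚ) : ℂ) / r := by
    rw [lValueDisc, hB1, map_div₀, map_neg, map_natCast, eq_ratCast]
  -- the right side: `ζ(r)`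
  have hser : LSeries (fun n => (chiDisc 1 n : ℂ)) r = riemannZeta r := by
    rw [← LSeries_one_eq_riemannZeta hs]
    congr 1
    funext n
    rw [chiDisc_one_left, Int.cast_one, Pi.one_apply]
  have hζ : riemannZeta r = (-1) ^ (k + 1) * (2 : ℂ) ^ (2 * k - 1) * (Real.pi : ℂ) ^ (2 * k) * bernoulli (2 * k) /
      (2 * k).factorial := by
    rw [hrk, Nat.cast_mul, Nat.cast_two, riemannZeta_two_mul_nat hk0]
  have hfac' : ((2 * k).factorial : ℂ) = (2 * k : ℕ) * ((2 * k - 1).factorial : ℂ) := by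
    rw [← Nat.mul_factorial_pred (by omega : 2 * k ≠ 0)]
    push_cast
    ring
  have hπ : (Real.pi : ℂ) ≠ 0 := by exact_mod_cast Real.pi_ne_zero
  have hfac : (((2 * k - 1).factorial : ℕ) : ℂ) ≠ 0 := by exact_mod_cast (2 * k - 1).factorial_ne_zero
  have hkC : ((2 * k : ℕ) : ℂ) ≠ 0 := by exact_mod_cast (show 2 * k ≠ 0 by omega)
  have hdiv : r / 2 = k := by omega
  rw [hL, hser, hζ, hdiv, hrk, Int.natAbs_one, hfac']
  simp only [Nat.cast_one, one_pow, Real.sqrt_one, ofReal_one, mul_one]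
  rcases Nat.even_or_odd k with he | ho
  · rw [he.neg_one_pow, he.add_one.neg_one_pow]
    field_simp
  · rw [ho.neg_one_pow, ho.add_one.neg_one_pow]
    field_simp

/-- **The character-free reading, for `D = 1` or `D` fundamental** (exactly the first clause of Cohen's
`IsDiscDecomposition`): for `r ≥ 2` with `D > 0`, `r` even, or `D < 0`, `r` odd,
`L(1 − r, χ_D) = (−1)^{⌊r/2⌋} (r−1)!/2^{r−1} · |D|^{r−1} √|D| π^{−r} · Σ_{n ≥ 1} χ_D(n) n^{−r}` in `ℂ`, the series taken with the
integer weights `chiDisc D n` (Mathlib `LSeries`). [cite: Cohen1975, §2 (definition of h(r,N) and of H(r,N))]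
[cite: MontgomeryVaughan2007, §9.3, Thm. 9.17] -/
theorem algebraMap_lValueDisc_eq_LSeries_chiDisc {D : ℤ}
    (hD : D = 1 ∨ (D % 4 = 1 ∧ Squarefree D ∧ D ≠ 1) ∨ (4 ∣ D ∧ (D / 4 % 4 = 2 ∨ D / 4 % 4 = 3) ∧ Squarefree (D / 4)))
    {r : ℕ} (hr : 2 ≤ r) (hpar : (0 < D ∧ Even r) ∨ (D < 0 ∧ Odd r)) :
    algebraMap ℚ ℂ (lValueDisc r D) =
      (-1 : ℂ) ^ (r / 2) * ((r - 1).factorial : ℂ) / 2 ^ (r - 1) * (D.natAbs : ℂ) ^ (r - 1) *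
        (Real.sqrt D.natAbs : ℂ) / (Real.pi : ℂ) ^ r * LSeries (fun n => (chiDisc D n : ℂ)) r := by
  rcases hD with rfl | hD
  · have hev : Even r := by
      rcases hpar with ⟨-, h⟩ | ⟨h, -⟩
      · exact h
      · norm_num at h
    exact algebraMap_lValueDisc_one_eq_LSeries hr hev
  · have hD' : IsFundamentalDiscriminant D := hD
    haveI : NeZero D.natAbs := ⟨by have := three_le_natAbs_of_isFundamentalDiscriminant hD'; omega⟩
    rw [algebraMap_lValueDisc_eq_LFunction_kroneckerChar hD' hr hpar, LFunction_kroneckerChar_eq_LSeries_chiDisc hD' hr]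

/-! ## §5 Cohen's `H(r, N)` through the convergent series — parity-free -/

/-- **`H(r, N) = (−1)^{⌊r/2⌋} (r−1)!/2^{r−1} · |D|^{r−1} √|D| π^{−r} · (Σ_{n ≥ 1} χ_D(n) n^{−r}) · T_r(D, f)`** in `ℂ`, for every
decomposition `(−1)^r N = D f²` of Cohen's definition (`D = 1` or fundamental, `f ≥ 1`) and every `r ≥ 2` — Cohen's own description
`H(r, N) = h(r, N/f²)·T` with `h(r, |D|) = (−1)^{[r/2]} (r−1)! |D|^{r−1/2} 2^{1−r} π^{−r} L(r, χ_D)`. The parity condition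
`χ_D(−1) = (−1)^r` is automatic here: `sign D = (−1)^r` because `N, f² > 0`.
[cite: Cohen1975, §2 (definition of h(r,N) and of H(r,N))] -/
theorem algebraMap_cohenH_eq_LSeries_chiDisc_mul_cohenT {r N : ℕ} {D : ℤ} {f : ℕ} (h : IsDiscDecomposition r N D f)
    (hr : 2 ≤ r) :
    algebraMap ℚ ℂ (cohenH r N) =
      (-1 : ℂ) ^ (r / 2) * ((r - 1).factorial : ℂ) / 2 ^ (r - 1) * (D.natAbs : ℂ) ^ (r - 1) *
        (Real.sqrt D.natAbs : ℂ) / (Real.pi : ℂ) ^ r * LSeries (fun n => (chiDisc D n : ℂ)) r * (cohenT r D f : ℂ) := by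
  have hD := h.1
  have hf := h.2.1
  have hM := h.2.2
  -- `N ≠ 0` (a fundamental discriminant, or `1`, is non-zero) and the sign of `D`
  have hD0 : D ≠ 0 := by
    rcases hD with rfl | hD
    · exact one_ne_zero
    · rintro rfl
      rcases hD with ⟨h1, -, -⟩ | ⟨-, h23, -⟩ <;> omega
  have hf2 : 0 < (f : ℤ) ^ 2 := by positivity
  have hN0 : (N : ℤ) ≠ 0 := by
    intro hN
    rw [hN, mul_zero] at hM
    exact hD0 ((mul_eq_zero.mp hM.symm).resolve_right hf2.ne')
  have hNpos : 0 < (N : ℤ) := lt_of_le_of_ne (by positivity) (Ne.symm hN0)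
  have hpar : (0 < D ∧ Even r) ∨ (D < 0 ∧ Odd r) := by
    rcases Nat.even_or_odd r with hev | hod
    · refine Or.inl ⟨?_, hev⟩
      rw [hev.neg_one_pow, one_mul] at hM
      nlinarith
    · refine Or.inr ⟨?_, hod⟩
      rw [hod.neg_one_pow, neg_one_mul] at hM
      nlinarith
  rw [cohenH_eq h, map_mul, map_intCast, algebraMap_lValueDisc_eq_LSeries_chiDisc hD hr hpar]

end Literature.NumberTheory.ModularForms.CohenEisenstein

end
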